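import Literature.NumberTheory.LFunctions.Zhang2022.KnifeEdgeEllThinBDH
import Literature.NumberTheory.LFunctions.Zhang2022.TypedSection15A

/-!
# §D edge ell — card `prime-discharge-thin-bdh`, thesis X / crux K1 «ThinBDH(A,B;κ*) for Zhang's κ* = κ₁∗b»:
# Zhang's `κ₁` at FREE scales and the thesis typed MODULO the (12.2)/(15.2) coefficient family `b`

Y. Zhang, *Discrete mean estimates and the Landau–Siegel zero*, arXiv:2211.02515v1 [Zhang2022LandauSiegel] — an
unrefereed manuscript under adjudication. **WHAT THIS IS NOT: not a claim about Theorems 1–2 of arXiv:2211.02515, about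
Landau–Siegel zeros, about Parity, or about a repaired `Margin232`. `ThinBDHZhangAt` / `ThinBDHZhang` are bare `Prop`s —
the card's crux K1, OPEN (the ideator: GRH-true for `D ≥ D₀(A,B,c)`, unconditionally of q-aspect density-hypothesis
strength), asserted by no one. The programme SEARCHES and TYPES; no claim about Landau–Siegel zeros, Theorems 1–2 of
arXiv:2211.02515 or a repaired Margin232 until a kernel theorem says so.** (LANDAU–SIEGEL programme F-S3, cell
`landau-siegel`, §D edge ell; card `prime-discharge-thin-bdh`, ls-knife-ell-idea-1 g2, commit 778cb19b7865; typer
ls-knife-typer-2 g4; companion of `KnifeEdgeEllThinBDH` (E-016′, `ThinBDH`, the bridge K2).)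

## What is typed, and what is NOT

Zhang's `κ* = κ₁∗b` (§15 p.81, tex L4064–L4086): `κ₁` is given by `ζ(s+β₁)ζ(s+β₂)/ζ(s) = Σ κ₁(m)m^{−s}` — the tree's
`MeanSquareMajorant.kappa₁ b₁ b₂` with REAL shift heights `β_j = ib_j` — and `b` is the coefficient sequence of
`B(s,ψ) = (H₁₄ + ι₂H₁₂)H₂` ((12.2), (15.1)–(15.2): `b(n) ≪ τ₂(n)`, `b(n) = 0` for `n > PT⁻²η₊`). At the manuscript's PINNED
scales both are typed (`Typed.Section15A.kappa1 c' D`, `kappaStar1 c' D b`, printed `b = Skeleton.bcoef D`). At the card's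
FREE scales `S` (`P = D^A`, `T = D^B`):

* `b1At c' S`, `b2At c' S` — the real heights of `β₁ = iα(1 − 5c′α𝓛)`, `β₂ = 2iα(1 + c′α𝓛)` at scale `S` (`α = π/log P`;
  `EllScales.beta1 c' S = i·b1At c' S`, `beta1_eq_I_mul_b1At`); `b1At_pinned`/`b2At_pinned` (`= Skeleton.b1/b2` at
  `Scales.pinned D`);
* `kappaOneAt c' S := MeanSquareMajorant.kappa₁ (b1At c' S) (b2At c' S)` — **Zhang's `κ₁` at free scales** (typed in full;
  `kappaOneAt_pinned : kappaOneAt c' (pinned D) = Typed.Section15A.kappa1 c' D`);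
* `kappaStarAt c' S b := MeanSquareMajorant.conv (kappaOneAt c' S) b` — `κ* = κ₁∗b` for a coefficient sequence `b`
  (`kappaStarAt_pinned`);
* `Eq152At S Bτ b` — (15.2) at free scales as a hypothesis ON `b` (`|b(n)| ≤ Bτ·τ₂(n)`, `b(n) = 0` for `n > (P/T²)·η₊`,
  `η₊ = Skeleton.etaPM D 1`); `eq152At_pinned_iff` relates it to the shape of `Typed.Section15A.Eq15_2`;
* **`ThinBDHZhangAt A B c c' b := ThinBDHAt A B c (D ↦ kappaStarAt c' (scalesAt A B D) (b D))`** and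
  **`ThinBDHZhang A B c' b := ThinBDH A B (…)`** — the card's thesis X / crux K1 **MODULO `b`**: the coefficient family
  `b : D ↦ b_D` is an explicit ARGUMENT, because the free-scale twin of (12.2)'s `b` (the polynomials `H₁₄, ι₂, H₁₂, H₂` at
  `P = D^A`, `T = D^B`) is NOT typed in the tree — the route that carries K1 supplies it (and the card's K3 audits it); the
  intended instance is «(12.2)'s `b` at free scales», whose pinned twin is `Skeleton.bcoef`;
* `faithfulBoundFor_zhang_of_bridge` — composition with the bridge K2: `ThinBDHBridge A B → ThinBDHZhangAt A B c c' b →`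
  E-016′'s conclusion `FaithfulBoundFor A B (κ₁∗b)` on the window `B ∈ (¼ + c, ½)`.

References: Zhang, arXiv:2211.02515v1, §2 (2.10), (2.13); §12 (12.2); §15 p.81 (κ₁, κ₁*), (15.1)–(15.2)
[cite: Zhang2022LandauSiegel, §15 (15.1)–(15.2) pp.79–81; §2 (2.13)].
-/

noncomputable section

open Complex Real

namespace Literature.NumberTheory.LFunctions.Zhang2022.KnifeEdgeEll.PrimeDischarge

open KnifeEdge EllScales Skeleton

/-! ## The shift heights and `κ₁` at free scales -/

/-- The real height of `β₁ = iα(1 − 5c′α𝓛)` (2.13) at scale `S`: `b₁ = α(1 − 5c′α𝓛)`, `α = π/log P`, `𝓛 = log D`.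
[cite: Zhang2022LandauSiegel, §2 (2.10), (2.13)] -/
def b1At (c' : ℝ) (S : Scales) : ℝ := S.alpha * (1 - 5 * c' * S.alpha * S.logD)

/-- The real height of `β₂ = 2iα(1 + c′α𝓛)` (2.13) at scale `S`. [cite: Zhang2022LandauSiegel, §2 (2.10), (2.13)] -/
def b2At (c' : ℝ) (S : Scales) : ℝ := 2 * S.alpha * (1 + c' * S.alpha * S.logD)

/-- `β₁ = i·b₁` at scale `S` (`EllScales.beta1`). [cite: Zhang2022LandauSiegel, §2 (2.13)] -/
theorem beta1_eq_I_mul_b1At (c' : ℝ) (S : Scales) : EllScales.beta1 c' S = I * (b1At c' S : ℂ) := by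
  unfold EllScales.beta1 b1At; push_cast; ring

/-- `β₂ = i·b₂` at scale `S` (`EllScales.beta2`). [cite: Zhang2022LandauSiegel, §2 (2.13)] -/
theorem beta2_eq_I_mul_b2At (c' : ℝ) (S : Scales) : EllScales.beta2 c' S = I * (b2At c' S : ℂ) := by
  unfold EllScales.beta2 b2At; push_cast; ring

/-- At the pinned scales `b₁` is the skeleton's `Skeleton.b1`. [cite: Zhang2022LandauSiegel, §2 (2.13)] -/
theorem b1At_pinned (c' : ℝ) (D : ℕ) : b1At c' (Scales.pinned D) = Skeleton.b1 c' D := by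
  unfold b1At Skeleton.b1
  rw [Scales.pinned_alpha]
  rfl

/-- At the pinned scales `b₂` is the skeleton's `Skeleton.b2`. [cite: Zhang2022LandauSiegel, §2 (2.13)] -/
theorem b2At_pinned (c' : ℝ) (D : ℕ) : b2At c' (Scales.pinned D) = Skeleton.b2 c' D := by
  unfold b2At Skeleton.b2
  rw [Scales.pinned_alpha]
  rfl

/-- **Zhang's `κ₁` at free scales**: `Σ_m κ₁(m)m^{−s} = ζ(s+β₁)ζ(s+β₂)/ζ(s)` with the scale-`S` heights, i.e. the tree's
`MeanSquareMajorant.kappa₁ (b1At c' S) (b2At c' S)` (the Dirichlet convolution `n^{−β₁} ∗ n^{−β₂} ∗ μ`).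
[cite: Zhang2022LandauSiegel, §15 p.81 (tex L4064)] -/
def kappaOneAt (c' : ℝ) (S : Scales) : ArithmeticFunction ℂ :=
  MeanSquareMajorant.kappa₁ (b1At c' S) (b2At c' S)

/-- Regression: at the pinned scales `κ₁` is the typed §15 object `Typed.Section15A.kappa1`.
[cite: Zhang2022LandauSiegel, §15 p.81] -/
theorem kappaOneAt_pinned (c' : ℝ) (D : ℕ) : kappaOneAt c' (Scales.pinned D) = Typed.Section15A.kappa1 c' D := by
  unfold kappaOneAt Typed.Section15A.kappa1
  rw [b1At_pinned, b2At_pinned]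

/-- **`κ* = κ₁∗b` at free scales** for a coefficient sequence `b` (`MeanSquareMajorant.conv`).
[cite: Zhang2022LandauSiegel, §15 p.81 (tex L4085)] -/
def kappaStarAt (c' : ℝ) (S : Scales) (b : ℕ → ℂ) : ℕ → ℂ := MeanSquareMajorant.conv (kappaOneAt c' S) b

/-- Regression: at the pinned scales `κ₁∗b` is `Typed.Section15A.kappaStar1 c' D b`. [cite: Zhang2022LandauSiegel, §15 p.81] -/
theorem kappaStarAt_pinned (c' : ℝ) (D : ℕ) (b : ℕ → ℂ) :
    kappaStarAt c' (Scales.pinned D) b = Typed.Section15A.kappaStar1 c' D b := by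
  unfold kappaStarAt Typed.Section15A.kappaStar1
  rw [kappaOneAt_pinned]

/-! ## (15.2) at free scales — the hypothesis ON the coefficient sequence `b` -/

/-- **(15.2) at scale `S`** as a hypothesis on a sequence `b`: `|b(n)| ≤ Bτ·τ₂(n)` and `b(n) = 0` for `n > (P/T²)·η₊`
(`τ₂ = MeanSquareMajorant.tau 2`, `η₊ = exp(𝓛⁻¹⁰) = Skeleton.etaPM D 1`; pinned shape = `Typed.Section15A.Eq15_2`).
[cite: Zhang2022LandauSiegel, §15 (15.2) p.79] -/
def Eq152At (S : Scales) (Bτ : ℝ) (b : ℕ → ℂ) : Prop :=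
  (∀ n : ℕ, ‖b n‖ ≤ Bτ * MeanSquareMajorant.tau 2 n) ∧
    ∀ n : ℕ, S.P / S.T ^ 2 * Skeleton.etaPM S.D 1 < n → b n = 0

/-- Regression of the SHAPE: at the pinned scales `Eq152At (pinned D) C (bcoef D)` is the `D`-instance of
`Typed.Section15A.Eq15_2`'s body. [cite: Zhang2022LandauSiegel, §15 (15.2) p.79] -/
theorem eq152At_pinned_iff (D : ℕ) (C : ℝ) :
    Eq152At (Scales.pinned D) C (Skeleton.bcoef D) ↔
      ((∀ n : ℕ, ‖Skeleton.bcoef D n‖ ≤ C * MeanSquareMajorant.tau 2 n) ∧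
        ∀ n : ℕ, Skeleton.bigP D / Skeleton.bigT D ^ 2 * Skeleton.etaPM D 1 < n → Skeleton.bcoef D n = 0) := by
  unfold Eq152At
  rw [Scales.pinned_P, Scales.pinned_T]
  rfl

/-! ## The card's thesis X / crux K1, modulo `b` -/

/-- **Crux K1 of the card with the saving exponent displayed, MODULO `b` (OPEN; asserted by no one):** `ThinBDHAt A B c`
for Zhang's family `D ↦ κ₁∗b_D` at the scales `scalesAt A B D`, the coefficient family `b : D ↦ b_D` being an explicit
argument (intended: (12.2)'s `b` at free scales — not typed in the tree; pinned twin `Skeleton.bcoef`; the card's K3 is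
the audit of this `b`). [cite: Zhang2022LandauSiegel, §14 (14.6)–(14.8) p.79; §15 p.81, (15.1)–(15.2)] -/
def ThinBDHZhangAt (A B c c' : ℝ) (b : ℕ → ℕ → ℂ) : Prop :=
  ThinBDHAt A B c fun D => kappaStarAt c' (scalesAt A B D) (b D)

/-- **Thesis X / crux K1 of the card, MODULO `b`:** `ThinBDH A B (D ↦ κ₁∗b_D)` (`= ∃ c > 0, ThinBDHZhangAt A B c c' b`).
OPEN; asserted by no one. [cite: Zhang2022LandauSiegel, §14 (14.6)–(14.8) p.79; §15 p.81, (15.1)–(15.2)] -/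
def ThinBDHZhang (A B c' : ℝ) (b : ℕ → ℕ → ℂ) : Prop :=
  ThinBDH A B fun D => kappaStarAt c' (scalesAt A B D) (b D)

/-- Unfolding: `ThinBDHZhang A B c' b ↔ ∃ c > 0, ThinBDHZhangAt A B c c' b`. [cite: Zhang2022LandauSiegel, §14 (14.8) p.79] -/
theorem thinBDHZhang_iff (A B c' : ℝ) (b : ℕ → ℕ → ℂ) :
    ThinBDHZhang A B c' b ↔ ∃ c : ℝ, 0 < c ∧ ThinBDHZhangAt A B c c' b := Iff.rfl

/-- **Composition with the bridge K2** (the route's one-line assembly for the error term E4): a TRUE bridge and the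
thesis at saving `c` on the window `B ∈ (¼ + c, ½)` give E-016′'s conclusion for Zhang's family `κ₁∗b`.
[cite: Zhang2022LandauSiegel, §14 (14.5)–(14.8) pp.78–79] -/
theorem faithfulBoundFor_zhang_of_bridge {A B c c' : ℝ} {b : ℕ → ℕ → ℂ} (hbr : ThinBDHBridge A B) (hc : 0 < c)
    (hB : 1 / 4 + c < B) (hB' : B < 1 / 2) (hX : ThinBDHZhangAt A B c c' b) :
    FaithfulBoundFor A B fun D => kappaStarAt c' (scalesAt A B D) (b D) :=
  faithfulBoundFor_of_bridge hbr hc hB hB' hX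

end Literature.NumberTheory.LFunctions.Zhang2022.KnifeEdgeEll.PrimeDischarge
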